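import Mathlib

/-!
# Non-degeneracy of digit functionals of `(pT + r, qT + r')` (stub `stub_digitFunctional`)

The stub `stub_digitFunctional` of the crux `MobiusLadder.QuadraticDigitPhases`
(stmt-QuantumAdvantage-1391), line `Sketch`, with its (elementary) lemmas.  Mathlib only.

For distinct odd primes `p, q`, initial carries `r < p`, `r' < q` and coefficients
`α β : ℕ → ZMod 2` vanishing above the top active position `j`, the `𝔽₂`-linear digit
functional `F(T) = Σ_{i<K} (α i · bit_i (pT + r) + β i · bit_i (qT + r'))` takes each of its
two values on at least `2^K / (4pq)` of the inputs `T < 2^K`, as soon as `2^(j-1) ≥ 4pq`.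

Proof.  Adding `2^j s` to `T` leaves the digits below `j` unchanged and adds `p s` (resp. `q s`)
to the digit quotient at position `j`, so `F(T + 2^j s) = F(T) + (α j + β j) s` (`sum_add_pow`):
`F` is `2^(j+1)`-periodic, and if exactly one of `α j, β j` is nonzero then `T ↦ T + 2^j`
flips `F`, so `F` is exactly balanced (pairing `pair_count` + periodic counting
`card_filter_periodic`, assembled in `count_two_le`).  If `α j = β j = 1`, `F` is
`2^j`-periodic and, with `L = 2^(j-1)` and the carries `ρ = ⌊(px + r)/L⌋`, `ρ' = ⌊(qx + r')/L⌋`,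
`F(x + L) = F(x) + ρ + ρ' + (p-1)/2 + (q-1)/2 + α (j-1) + β (j-1)` (`sum_add_half`, from the
carry recursion `⌊(ρ + p)/2⌋ ≡ ⌊ρ/2⌋ + ρ + (p-1)/2`).  Hence `x ↦ x + L` flips `F` on the
`x < L` with a prescribed parity of `ρ + ρ'`, and both parities occur for at least
`L/(pq) - 1` values of `x < L` (`card_parity_ge`: `ρ = ρ' = 0` for `x < L/q`, and
`(ρ, ρ') = (0, 1)` on an interval of length `L/(pq) - 1` beyond `L/q`, when `p < q`); this is
assembled in `count_four_le`.
-/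

set_option linter.dupNamespace false -- D-0017: single-problem summit ⇒ `QuantumAdvantage.QuantumAdvantage` by design

namespace Summit.QuantumAdvantage.QuantumAdvantage.Theorems.MobiusLadderQuadraticDigitPhasesStubDigitFunctional

open Finset

/-! ## Binary digits as elements of `ZMod 2` -/

/-- `bit_i n = ⌊n / 2^i⌋ (mod 2)`. -/
theorem bit_eq (n i : ℕ) :
    (if Nat.testBit n i then (1 : ZMod 2) else 0) = ((n / 2 ^ i : ℕ) : ZMod 2) := by
  rw [Nat.testBit_eq_decide_div_mod_eq, ← ZMod.natCast_mod (n / 2 ^ i) 2]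
  rcases Nat.mod_two_eq_zero_or_one (n / 2 ^ i) with h | h <;> simp [h]

/-- Adding a multiple of `2^i` shifts the digit quotient at position `i` by that multiple. -/
theorem bit_add (m a i : ℕ) :
    (if Nat.testBit (m + 2 ^ i * a) i then (1 : ZMod 2) else 0) =
      (if Nat.testBit m i then (1 : ZMod 2) else 0) + a := by
  rw [bit_eq, bit_eq, Nat.add_mul_div_left _ _ (Nat.two_pow_pos i), Nat.cast_add]

/-- Adding a multiple of `2^j` does not change the digits below `j`. -/
theorem bit_add_lt (m a i j : ℕ) (h : i < j) :
    (if Nat.testBit (m + 2 ^ j * a) i then (1 : ZMod 2) else 0) =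
      (if Nat.testBit m i then (1 : ZMod 2) else 0) := by
  obtain ⟨d, rfl⟩ := Nat.exists_eq_add_of_lt h
  rw [show 2 ^ (i + d + 1) * a = 2 ^ i * (2 * (2 ^ d * a)) by ring, bit_add, Nat.cast_mul,
    ZMod.natCast_self, zero_mul, add_zero]

/-- The digit at position `k+1` is `⌊⌊n/2^k⌋/2⌋ (mod 2)`. -/
theorem bit_succ (n k : ℕ) :
    (if Nat.testBit n (k + 1) then (1 : ZMod 2) else 0) = ((n / 2 ^ k / 2 : ℕ) : ZMod 2) := by
  rw [bit_eq, Nat.div_div_eq_div_mul, ← pow_succ]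

/-- Carry recursion modulo 2: `⌊(ρ + p)/2⌋ ≡ ⌊ρ/2⌋ + ρ + p' (mod 2)` for `p = 2p' + 1`. -/
theorem cast_half_add_odd (ρ p' : ℕ) :
    (((ρ + (2 * p' + 1)) / 2 : ℕ) : ZMod 2) = ((ρ / 2 : ℕ) : ZMod 2) + ρ + p' := by
  rw [show (ρ + (2 * p' + 1)) / 2 = ρ / 2 + ρ % 2 + p' by omega, Nat.cast_add, Nat.cast_add,
    ZMod.natCast_mod]

/-! ## Shift identities for the digit functional -/

/-- Shifting the input by `2^j s` changes `F` by `(α j + β j) s` when nothing is active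
above `j`. -/
theorem sum_add_pow (p q r r' : ℕ) (α β : ℕ → ZMod 2) (K j : ℕ) (hp : Odd p) (hq : Odd q)
    (hjK : j < K) (hz : ∀ i, j < i → α i = 0 ∧ β i = 0) (T s : ℕ) :
    ∑ i ∈ range K, (α i * (if Nat.testBit (p * (T + 2 ^ j * s) + r) i then 1 else 0) +
        β i * (if Nat.testBit (q * (T + 2 ^ j * s) + r') i then 1 else 0)) =
      ∑ i ∈ range K, (α i * (if Nat.testBit (p * T + r) i then 1 else 0) +
        β i * (if Nat.testBit (q * T + r') i then 1 else 0)) + (α j + β j) * s := by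
  rw [show p * (T + 2 ^ j * s) + r = p * T + r + 2 ^ j * (p * s) by ring,
    show q * (T + 2 ^ j * s) + r' = q * T + r' + 2 ^ j * (q * s) by ring,
    ← sub_eq_iff_eq_add', ← sum_sub_distrib,
    sum_eq_single_of_mem j (mem_range.mpr hjK)]
  · rw [bit_add, bit_add, Nat.cast_mul, Nat.cast_mul,
      ZMod.natCast_eq_one_iff_odd.mpr hp, ZMod.natCast_eq_one_iff_odd.mpr hq]
    ring
  · intro i _ hij
    rcases Nat.lt_or_gt_of_ne hij with h | h
    · rw [bit_add_lt _ _ _ _ h, bit_add_lt _ _ _ _ h, sub_self]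
    · rw [(hz i h).1, (hz i h).2]
      ring

/-- Two-sided top (`α (k+1) = β (k+1) = 1`): shifting the input by `L = 2^k` changes `F`
by `ρ + ρ' + p' + q' + α k + β k`, where `ρ = ⌊(px + r)/L⌋`, `ρ' = ⌊(qx + r')/L⌋` are the
carries into position `k` and `p = 2p' + 1`, `q = 2q' + 1`. -/
theorem sum_add_half (p q r r' p' q' : ℕ) (α β : ℕ → ZMod 2) (K k : ℕ) (hp : p = 2 * p' + 1)
    (hq : q = 2 * q' + 1) (hkK : k + 1 < K) (hz : ∀ i, k + 1 < i → α i = 0 ∧ β i = 0)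
    (ha : α (k + 1) = 1) (hb : β (k + 1) = 1) (x : ℕ) :
    ∑ i ∈ range K, (α i * (if Nat.testBit (p * (x + 2 ^ k) + r) i then 1 else 0) +
        β i * (if Nat.testBit (q * (x + 2 ^ k) + r') i then 1 else 0)) =
      ∑ i ∈ range K, (α i * (if Nat.testBit (p * x + r) i then 1 else 0) +
        β i * (if Nat.testBit (q * x + r') i then 1 else 0)) +
      ((((p * x + r) / 2 ^ k : ℕ) : ZMod 2) + (((q * x + r') / 2 ^ k : ℕ) : ZMod 2) +
        (p' + q' + (α k + β k))) := by
  rw [show p * (x + 2 ^ k) + r = p * x + r + 2 ^ k * p by ring,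
    show q * (x + 2 ^ k) + r' = q * x + r' + 2 ^ k * q by ring,
    ← sub_eq_iff_eq_add', ← sum_sub_distrib,
    sum_eq_add_of_mem (k + 1) k (mem_range.mpr hkK) (mem_range.mpr (by omega)) (by omega)]
  · rw [ha, hb, bit_succ _ k, bit_succ _ k, bit_succ _ k, bit_succ _ k,
      Nat.add_mul_div_left _ _ (Nat.two_pow_pos k),
      Nat.add_mul_div_left _ _ (Nat.two_pow_pos k),
      bit_add, bit_add, hp, hq, cast_half_add_odd, cast_half_add_odd,
      ZMod.natCast_eq_one_iff_odd.mpr (odd_two_mul_add_one p'),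
      ZMod.natCast_eq_one_iff_odd.mpr (odd_two_mul_add_one q')]
    ring
  · rintro i - ⟨h1, h2⟩
    rcases Nat.lt_or_gt_of_ne h2 with h | h
    · rw [bit_add_lt _ _ _ _ h, bit_add_lt _ _ _ _ h, sub_self]
    · rw [(hz i (by omega)).1, (hz i (by omega)).2]
      ring

/-! ## Counting lemmas -/

/-- Iterating a period. -/
theorem periodic_iter (P : ℕ → Prop) (N : ℕ) (hP : ∀ T, P (T + N) ↔ P T) :
    ∀ M x, P (N * M + x) ↔ P x
  | 0, x => by rw [Nat.mul_zero, Nat.zero_add]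
  | M + 1, x => by
    rw [show N * (M + 1) + x = N * M + x + N by ring, hP, periodic_iter P N hP M x]

/-- Counting an `N`-periodic predicate over `M` periods. -/
theorem card_filter_periodic (P : ℕ → Prop) [DecidablePred P] (N : ℕ)
    (hP : ∀ T, P (T + N) ↔ P T) :
    ∀ M, ((range (N * M)).filter P).card = M * ((range N).filter P).card
  | 0 => by simp
  | M + 1 => by
    rw [Nat.mul_succ, card_filter, sum_range_add, ← card_filter, ← card_filter,
      card_filter_periodic P N hP M, Nat.succ_mul, Nat.add_left_cancel_iff, card_filter,
      card_filter]
    exact sum_congr rfl fun x _ => by simp only [periodic_iter P N hP M x]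

/-- PAIRING: if `x ↦ x + N` flips `g` on `S ⊆ [0, N)`, then `g` takes every value at least `#S`
times on `[0, 2N)`. -/
theorem pair_count (g : ℕ → ZMod 2) (N : ℕ) (S : Finset ℕ) (hS : ∀ x ∈ S, x < N)
    (hg : ∀ x ∈ S, g (x + N) = g x + 1) (v : ZMod 2) :
    S.card ≤ ((range (N * 2)).filter (fun T => g T = v)).card := by
  have flip : ∀ a w : ZMod 2, a ≠ w → a + 1 = w := by decide
  refine card_le_card_of_injOn (fun x => if g x = v then x else x + N) ?_ ?_
  · intro x hx
    have hxS : x ∈ S := hx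
    have hxN := hS x hxS
    simp only [coe_filter, Set.mem_setOf_eq, mem_range]
    by_cases h : g x = v
    · rw [if_pos h]
      exact ⟨by omega, h⟩
    · rw [if_neg h, hg x hxS]
      exact ⟨by omega, flip _ _ h⟩
  · intro x hx x' hx' he
    have hxN := hS x hx
    have hxN' := hS x' hx'
    dsimp only at he
    by_cases h : g x = v
    · by_cases h' : g x' = v
      · rwa [if_pos h, if_pos h'] at he
      · rw [if_pos h, if_neg h'] at he; omega
    · by_cases h' : g x' = v
      · rw [if_neg h, if_pos h'] at he; omega
      · rw [if_neg h, if_neg h'] at he; omega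

/-- One-sided top: if `T ↦ T + 2^j` flips `F`, then `F` takes every value on at least half of
`[0, 2^K)` for `K > j`. -/
theorem count_two_le (F : ℕ → ZMod 2) (K j : ℕ) (hjK : j < K)
    (hflip : ∀ T, F (T + 2 ^ j) = F T + 1) (v : ZMod 2) :
    2 ^ K ≤ 2 * ((range (2 ^ K)).filter (fun T => F T = v)).card := by
  have hper : ∀ T, F (T + 2 ^ j * 2) = v ↔ F T = v := fun T => by
    rw [mul_two, ← add_assoc, hflip, hflip, add_assoc, show (1 : ZMod 2) + 1 = 0 from by decide,
      add_zero]
  have hpair := pair_count F (2 ^ j) (range (2 ^ j)) (fun x hx => mem_range.mp hx)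
    (fun x _ => hflip x) v
  rw [card_range] at hpair
  have hcount := card_filter_periodic (fun T => F T = v) (2 ^ j * 2) hper (2 ^ (K - j - 1))
  have hK : 2 ^ K = 2 ^ j * 2 * 2 ^ (K - j - 1) := by
    rw [← pow_succ, ← pow_add]; congr 1; omega
  rw [← hK] at hcount
  rw [hcount]
  calc 2 ^ K = 2 * (2 ^ (K - j - 1) * 2 ^ j) := by rw [hK]; ring
    _ ≤ _ := Nat.mul_le_mul_left _ (Nat.mul_le_mul_left _ hpair)

/-! ## Both parities of the carry pair occur with positive density -/

/-- For `p + 1 ≤ q`: among `x < L`, each parity of `⌊(px + r)/L⌋ + ⌊(qx + r')/L⌋` occurs at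
least `L/(pq) - 1` times (`(0, 0)` below `L/q`, `(0, 1)` on an interval beyond `L/q`). -/
theorem card_parity_ge_of_lt (p q r r' L : ℕ) (hp : 0 < p) (hpq : p + 1 ≤ q) (hr : r < p)
    (hr' : r' < q) (ε : ZMod 2) :
    L / (p * q) - 1 ≤ ((range L).filter (fun x =>
      (((p * x + r) / L : ℕ) : ZMod 2) + (((q * x + r') / L : ℕ) : ZMod 2) = ε)).card := by
  have hε : ε = 0 ∨ ε = 1 := by decide +revert
  have hDQ : L / (p * q) = L / q / p := by rw [Nat.div_div_eq_div_mul, mul_comm]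
  have hpD : p * (L / (p * q)) ≤ L / q := by rw [hDQ]; exact Nat.mul_div_le _ p
  have hqQ : q * (L / q) ≤ L := Nat.mul_div_le L q
  have hdm := Nat.div_add_mod L q
  have hml := Nat.mod_lt L (show 0 < q by omega)
  have hqD : q * (L / (p * q)) ≤ L / p := by
    rw [← Nat.div_div_eq_div_mul]; exact Nat.mul_div_le _ q
  have hLp : L / p ≤ L := Nat.div_le_self L p
  rcases hε with rfl | rfl
  · -- `ρ = ρ' = 0` for `x < L/q`
    calc L / (p * q) - 1 ≤ L / q := by
          rw [hDQ]; exact (Nat.sub_le _ _).trans (Nat.div_le_self _ _)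
      _ = (range (L / q)).card := (card_range _).symm
      _ ≤ _ := card_le_card fun x hx => ?_
    rw [mem_range] at hx
    have h1 : q * (x + 1) ≤ q * (L / q) := Nat.mul_le_mul_left q hx
    have h2 : p * (x + 1) ≤ q * (x + 1) := Nat.mul_le_mul_right (x + 1) (by omega)
    have h3 : x + 1 ≤ p * (x + 1) := Nat.le_mul_of_pos_left (x + 1) hp
    have e1 : p * (x + 1) = p * x + p := by ring
    have e2 : q * (x + 1) = q * x + q := by ring
    rw [mem_filter, mem_range, Nat.div_eq_of_lt (by omega : p * x + r < L),
      Nat.div_eq_of_lt (by omega : q * x + r' < L), Nat.cast_zero, add_zero]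
    exact ⟨by omega, rfl⟩
  · -- `(ρ, ρ') = (0, 1)` for `L/q < x < L/q + L/(pq)`
    calc L / (p * q) - 1 = (Ico (L / q + 1) (L / q + 1 + (L / (p * q) - 1))).card := by
          rw [Nat.card_Ico]; omega
      _ ≤ _ := card_le_card fun x hx => ?_
    rw [mem_Ico] at hx
    have h1 : p * (x + 1) ≤ p * (L / q + L / (p * q)) := Nat.mul_le_mul_left p (by omega)
    have h2 : (p + 1) * (L / q) ≤ q * (L / q) := Nat.mul_le_mul_right (L / q) hpq
    have h3 : q * (L / q + 1) ≤ q * x := Nat.mul_le_mul_left q hx.1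
    have h4 : q * (x + 1) ≤ q * (L / q + L / (p * q)) := Nat.mul_le_mul_left q (by omega)
    have h5 : x + 1 ≤ p * (x + 1) := Nat.le_mul_of_pos_left (x + 1) hp
    have e1 : p * (x + 1) = p * x + p := by ring
    have e2 : p * (L / q + L / (p * q)) = p * (L / q) + p * (L / (p * q)) := by ring
    have e3 : (p + 1) * (L / q) = p * (L / q) + L / q := by ring
    have e4 : q * (L / q + 1) = q * (L / q) + q := by ring
    have e5 : q * (x + 1) = q * x + q := by ring
    have e6 : q * (L / q + L / (p * q)) = q * (L / q) + q * (L / (p * q)) := by ring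
    rw [mem_filter, mem_range, Nat.div_eq_of_lt (by omega : p * x + r < L),
      Nat.div_eq_of_lt_le (k := 1) (by omega) (by omega), Nat.cast_zero, Nat.cast_one,
      zero_add]
    exact ⟨by omega, rfl⟩

/-- For distinct positive `p, q` (with `r < p`, `r' < q`): among `x < L`, each parity of
`⌊(px + r)/L⌋ + ⌊(qx + r')/L⌋` occurs at least `L/(pq) - 1` times. -/
theorem card_parity_ge (p q r r' L : ℕ) (hp : 0 < p) (hq : 0 < q) (hpq : p ≠ q)
    (hr : r < p) (hr' : r' < q) (ε : ZMod 2) :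
    L / (p * q) - 1 ≤ ((range L).filter (fun x =>
      (((p * x + r) / L : ℕ) : ZMod 2) + (((q * x + r') / L : ℕ) : ZMod 2) = ε)).card := by
  rcases lt_or_gt_of_ne hpq with h | h
  · exact card_parity_ge_of_lt p q r r' L hp h hr hr' ε
  · rw [mul_comm, filter_congr fun x _ => by rw [add_comm]]
    exact card_parity_ge_of_lt q p r' r L hq h hr' hr ε

/-- Arithmetic: `L ≤ 2 P (L/P - 1)` once `L ≥ 4P`. -/
theorem le_two_mul_of_le (L P : ℕ) (hP : 0 < P) (hL : 4 * P ≤ L) :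
    L ≤ 2 * (P * (L / P - 1)) := by
  have hdm := Nat.div_add_mod L P
  have hml := Nat.mod_lt L hP
  rw [Nat.mul_sub_one]
  omega

/-- Two-sided top: if `F` is `2^(k+1)`-periodic and `x ↦ x + 2^k` changes `F` by
`⌊(px + r)/2^k⌋ + ⌊(qx + r')/2^k⌋ + C`, then `F` takes every value on at least `2^K/(4pq)` of
`[0, 2^K)`, for `K > k + 1` and `2^k ≥ 4pq`. -/
theorem count_four_le (F : ℕ → ZMod 2) (p q r r' K k : ℕ) (C : ZMod 2) (hp : 0 < p)
    (hq : 0 < q) (hpq : p ≠ q) (hr : r < p) (hr' : r' < q) (hL : 4 * (p * q) ≤ 2 ^ k)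
    (hkK : k + 1 < K) (hper : ∀ T, F (T + 2 ^ (k + 1)) = F T)
    (hshift : ∀ x, F (x + 2 ^ k) = F x +
      ((((p * x + r) / 2 ^ k : ℕ) : ZMod 2) + (((q * x + r') / 2 ^ k : ℕ) : ZMod 2) + C))
    (v : ZMod 2) :
    2 ^ K ≤ 4 * (p * q) * ((range (2 ^ K)).filter (fun T => F T = v)).card := by
  set S : Finset ℕ := (range (2 ^ k)).filter (fun x =>
    (((p * x + r) / 2 ^ k : ℕ) : ZMod 2) + (((q * x + r') / 2 ^ k : ℕ) : ZMod 2) = 1 + C)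
    with hS
  have hflip : ∀ x ∈ S, F (x + 2 ^ k) = F x + 1 := by
    intro x hx
    rw [hS, mem_filter] at hx
    rw [hshift, hx.2]
    have h2 : (2 : ZMod 2) = 0 := by decide
    linear_combination C * h2
  have hpair := pair_count F (2 ^ k) S
    (fun x hx => by rw [hS, mem_filter] at hx; exact mem_range.mp hx.1) hflip v
  have hpar : 2 ^ k / (p * q) - 1 ≤ S.card := card_parity_ge p q r r' (2 ^ k) hp hq hpq hr hr' _
  have hcount := card_filter_periodic (fun T => F T = v) (2 ^ (k + 1))
    (fun T => by rw [hper]) (2 ^ (K - (k + 1)))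
  have hK : 2 ^ K = 2 ^ (k + 1) * 2 ^ (K - (k + 1)) := by
    rw [← pow_add]; congr 1; omega
  rw [← hK] at hcount
  rw [hcount]
  -- arithmetic: `2 (pq) (L/(pq) - 1) ≥ L` for `L = 2^k ≥ 4pq`
  have key := le_two_mul_of_le (2 ^ k) (p * q) (Nat.mul_pos hp hq) hL
  generalize 2 ^ k / (p * q) - 1 = D at key hpar
  calc 2 ^ K = 2 ^ (K - (k + 1)) * 2 * 2 ^ k := by rw [hK, pow_succ]; ring
    _ ≤ 2 ^ (K - (k + 1)) * 2 * (2 * (p * q * D)) := Nat.mul_le_mul_left _ key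
    _ = 4 * (p * q) * (2 ^ (K - (k + 1)) * D) := by ring
    _ ≤ 4 * (p * q) * (2 ^ (K - (k + 1)) * ((range (2 ^ k * 2)).filter
          (fun T => F T = v)).card) :=
        Nat.mul_le_mul_left _ (Nat.mul_le_mul_left _ (hpar.trans hpair))
    _ = _ := by rw [← pow_succ]

/-- From the two-sided natural-number counts to the real-number form of the stub. -/
theorem real_bounds (s : Finset ℕ) (F : ℕ → ZMod 2) (K : ℕ) (c : ℝ) (hc : 0 < c)
    (hs : s.card = 2 ^ K) (h : ∀ v, (2 : ℝ) ^ K ≤ c * ((s.filter (fun T => F T = v)).card : ℝ)) :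
    1 / c * (2 : ℝ) ^ K ≤ ((s.filter (fun T => F T = 1)).card : ℝ) ∧
      ((s.filter (fun T => F T = 1)).card : ℝ) ≤ (1 - 1 / c) * (2 : ℝ) ^ K := by
  have hsplit := card_filter_add_card_filter_not (s := s) (fun T => F T = 1)
  have hneg : (s.filter fun T => ¬ F T = 1) = s.filter fun T => F T = 0 :=
    filter_congr fun T _ => by
      have : ∀ a : ZMod 2, ¬ a = 1 ↔ a = 0 := by decide
      exact this _
  rw [hs, hneg] at hsplit
  have h1 := h 1
  have h0 := h 0
  have hs' : ((s.filter (fun T => F T = 1)).card : ℝ) + (s.filter (fun T => F T = 0)).card =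
      (2 : ℝ) ^ K := by exact_mod_cast hsplit
  have hB : (2 : ℝ) ^ K / c ≤ (s.filter (fun T => F T = 0)).card := by
    rw [div_le_iff₀ hc]; linarith
  constructor
  · rw [one_div_mul_eq_div, div_le_iff₀ hc]
    linarith
  · rw [show (1 - 1 / c) * (2 : ℝ) ^ K = 2 ^ K - 2 ^ K / c by ring]
    linarith

/-! ## The stub -/

/-- Core count (natural-number form): under the hypotheses of the stub with `2 ^ (j-1) ≥ 4pq`,
`F` takes each value `v` on at least `2^K/(4pq)` inputs `T < 2^K`. -/
theorem count_ge (p q r r' : ℕ) (α β : ℕ → ZMod 2) (K j : ℕ) (hp : Odd p) (hq : Odd q)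
    (hpq : p ≠ q) (hr : r < p) (hr' : r' < q) (hj : 1 ≤ j) (hL : 4 * (p * q) ≤ 2 ^ (j - 1))
    (hjK : j < K) (htop : α j ≠ 0 ∨ β j ≠ 0) (hz : ∀ i, j < i → α i = 0 ∧ β i = 0)
    (v : ZMod 2) :
    2 ^ K ≤ 4 * (p * q) * ((range (2 ^ K)).filter (fun T =>
      ∑ i ∈ range K, (α i * (if Nat.testBit (p * T + r) i then 1 else 0) +
        β i * (if Nat.testBit (q * T + r') i then 1 else 0)) = v)).card := by
  have hp0 : 0 < p := hp.pos
  have hq0 : 0 < q := hq.pos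
  have hcases : ∀ a b : ZMod 2, (a ≠ 0 ∨ b ≠ 0) → a + b = 1 ∨ (a = 1 ∧ b = 1) := by decide
  rcases hcases _ _ htop with hone | ⟨ha, hb⟩
  · -- one-sided top: `F (T + 2^j) = F T + 1`
    have h2 : 2 ≤ 4 * (p * q) := by have := Nat.mul_pos hp0 hq0; omega
    refine le_trans ?_ (Nat.mul_le_mul_right _ h2)
    refine count_two_le _ K j hjK (fun T => ?_) v
    have h := sum_add_pow p q r r' α β K j hp hq hjK hz T 1
    rw [mul_one, Nat.cast_one, mul_one, hone] at h
    exact h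
  · -- two-sided top: period `2^j`, pairing `x ↦ x + 2^(j-1)` on a parity set
    obtain ⟨k, rfl⟩ : ∃ k, j = k + 1 := ⟨j - 1, by omega⟩
    rw [Nat.add_sub_cancel] at hL
    obtain ⟨p', hp'⟩ := hp
    obtain ⟨q', hq'⟩ := hq
    refine count_four_le _ p q r r' K k ((p' : ZMod 2) + q' + (α k + β k)) hp0 hq0 hpq hr hr'
      hL hjK (fun T => ?_) (sum_add_half p q r r' p' q' α β K k hp' hq' hjK hz ha hb) v
    have h := sum_add_pow p q r r' α β K (k + 1) ⟨p', hp'⟩ ⟨q', hq'⟩ hjK hz T 1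
    rw [mul_one, Nat.cast_one, mul_one, ha, hb, show (1 : ZMod 2) + 1 = 0 from by decide,
      add_zero] at h
    exact h

/-- STUB `stub_digitFunctional` (non-degeneracy of digit functionals of `(pT + r, qT + r')`): an
`𝔽₂`-linear functional of the binary digits of `(pT + r, qT + r')` whose top active position `j`
satisfies `k₀ ≤ j < K` takes the value `1` on between `c 2^K` and `(1 - c) 2^K` of the inputs
`T < 2^K`, with `k₀ = 4pq + 1` and `c = 1/(4pq)`. -/
theorem stub_digitFunctional :
    ∀ p q : ℕ, p.Prime → q.Prime → p ≠ q → 2 < p → 2 < q →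
      ∃ k₀ : ℕ, ∃ c : ℝ, 0 < c ∧ ∀ K : ℕ, ∀ r : ℕ, r < p → ∀ r' : ℕ, r' < q → ∀ α β : ℕ → ZMod 2, ∀ j : ℕ,
        k₀ ≤ j → j < K → (α j ≠ 0 ∨ β j ≠ 0) → (∀ i : ℕ, j < i → α i = 0 ∧ β i = 0) →
        c * (2 : ℝ) ^ K ≤ (((Finset.range (2 ^ K)).filter (fun T =>
            ∑ i ∈ Finset.range K, (α i * (if Nat.testBit (p * T + r) i then 1 else 0) +
              β i * (if Nat.testBit (q * T + r') i then 1 else 0)) = (1 : ZMod 2))).card : ℝ) ∧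
        (((Finset.range (2 ^ K)).filter (fun T =>
            ∑ i ∈ Finset.range K, (α i * (if Nat.testBit (p * T + r) i then 1 else 0) +
              β i * (if Nat.testBit (q * T + r') i then 1 else 0)) = (1 : ZMod 2))).card : ℝ) ≤
          (1 - c) * (2 : ℝ) ^ K := by
  intro p q hp hq hpq h2p h2q
  have hpo : Odd p := hp.odd_of_ne_two (by omega)
  have hqo : Odd q := hq.odd_of_ne_two (by omega)
  have hpq0 : (0 : ℝ) < 4 * (p * q) := by positivity
  refine ⟨4 * (p * q) + 1, 1 / (4 * (p * q)), by positivity, ?_⟩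
  intro K r hr r' hr' α β j hj hjK htop hz
  have hL : 4 * (p * q) ≤ 2 ^ (j - 1) :=
    ((Nat.lt_two_pow_self).le).trans (Nat.pow_le_pow_right (by norm_num) (by omega))
  refine real_bounds (range (2 ^ K)) _ K _ hpq0 (card_range _) fun v => ?_
  exact_mod_cast count_ge p q r r' α β K j hpo hqo hpq hr hr' (by omega) hL hjK htop hz v

end Summit.QuantumAdvantage.QuantumAdvantage.Theorems.MobiusLadderQuadraticDigitPhasesStubDigitFunctional
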